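import Summits.BirchSwinnertonDyer.Rank1Residual.Additive.X4SharpThreeKimLattice
import Literature.NumberTheory.EllipticCurves.CuspFormLFunctionLevelConductorProofs
import Literature.NumberTheory.EllipticCurves.ModularParametrizationBCDTProofs
import HarnessLib

/-!
# The Kim-at-3 lattice, STEP-0 corner: the `∂`-exact shape `KimRankZeroShaLengthAt W p` is a THEOREM
# at every `p ≥ 5` for EVERY modular parametrisation datum (team n1011, OWNERS T-a2, §(η) η.8(3);
# seat p03; sibling of `X4SharpThreeKimLattice.lean`)

HONEST FRAMING (cell `b2b-bsdres`, run/shared/lean/b2b/bsd-rank1-residual/, verbatim in every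
file): the goal of the cell is to DELETE the COMBINATION-SHAPED residual classes of the
Birch–Swinnerton-Dyer formula for ALL analytic-rank `≤ 1` elliptic curves over `ℚ` — "full BSD
formula for every rank `≤ 1` curve in class `C`" assembled STRICTLY from published theorems — so
that the rank-`≤ 1` remainder becomes exactly the CONSTRUCTION-SHAPED classes, which are TYPED
(missing-input `Prop`s), NOT attempted. This is not "finishing BSD". Research routes; no claim beyond
stated classes; census output = EVIDENCE / conjecture items, never a Literature fact; nothing below
is booked; no label or mark changes. NOTHING is asserted: theorems whose every published input is an
explicit named-fact hypothesis; NO new `Prop`.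

## What this file proves

additive-p4's kernel discharge of Kim's Thm. 1.8 (6) at `p ≥ 5` in BSD currency,
`X4.kimShaLengthRankZeroAt_of_kimFacts_of_five_le` (file `X4/KimShaLengthFiveLe.lean`; inputs: the
two one-sided PUBLISHED facts `Kim2026.rankZero_le_padicValNat_sha_of_kuriharaNumber_ne_zero` (LOWER,
n1011-p11) and `Kim2026.rankZero_padicValNat_sha_add_le_of_forall_pow_dvd_kuriharaNumber_cyclicLevel`
(UPPER, harvest-2 E67c)), carries the binder `W.conductorNorm ℤ = N` — the datum must sit at the
conductor level, because the `∂`-unwinding reads the Kolyvagin condition `ℓ ∤ N·p` at the conductor.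
The implication lattice (cells/n1011/KIM-AT-3-ANATOMY.md §(η)) therefore recorded the node
A5 = `Additive.KimRankZeroShaLengthAt W p` (which quantifies over data of EVERY level) as "a theorem
at `p ≥ 5` for conductor-level data only" (non-edge η.8(3)). This file closes that gap: the level
of ANY modular parametrisation datum of an elliptic `W` IS the conductor — Carayol's theorem, in the
tree a consequence of the modularity theorem `exists_isNewformOf` by strong multiplicity one across
levels (`IsNewformOf.level_eq_conductorNorm_of_exists_isNewformOf`; the cell's standing hypothesis
`nonempty_modularParametrizationData` implies `exists_isNewformOf`). Hence:

* `kimRankZeroShaLengthAt_of_kimFacts_of_five_le`: F3 ∧ F4c ∧ modularity ∧ `5 ≤ p` ⟹ A5 — the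
  STEP-0 theorem of the `∂`-exact shape, the missing sibling of `kimRankZeroBoundAt_of_five_le`,
  `kimRankZeroUnitBoundAt_of_five_le`, `kimRankZeroLowerBoundAt_of_five_le`,
  `kimRankZeroUpperDivBoundAt_of_five_le`;
* the same with the cell's `nonempty_modularParametrizationData` in place of `exists_isNewformOf`;
* the verbatim core `X4.KimShaLengthAt W p D.f` at `p ≥ 5` (rank `0`) for every datum;
* the three certificate shapes A2 ∧ A3 ∧ A4 at `p ≥ 5` from F3 ∧ F4c ∧ modularity through A5 (the
  top of the per-pair lattice), for comparison with their direct STEP-0 theorems from F2 / F3 / F4.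

Flags of the facts inherited (`Kim-(6)-partial-reading`, `Kim2026-(6)-cyclic-reading`, referee to
rule which reading of (6) is of record). At `p = 3` nothing changes: A5 there is the announced [K25]
statement modulo integrality (`kimRankZeroShaLengthAt_of_kim2025_OPEN_of_integral`).

References: C.-H. Kim, Amer. J. Math. 148 (2026) = arXiv:2203.12159v4, Thm. 1.9 (6), §1.5.1
[Kim2022StructureSelmer]; Diamond–Shurman, *A First Course in Modular Forms*, Thm. 8.8.1 / 8.8.3
[DiamondShurman2005]; Atkin–Lehner 1970 Thm. 4 [AtkinLehner1970]; cell files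
cells/n1011/KIM-AT-3-ANATOMY.md §(η), cells/n1011/OWNERS.md (T-a2, T-N10K), X4/KimShaLengthFiveLe.lean.
-/

noncomputable section

open scoped Classical MatrixGroups ModularForm

open CongruenceSubgroup WeierstrassCurve Literature.NumberTheory.EllipticCurves
  Literature.NumberTheory.EllipticCurves.ModularForms
  Literature.NumberTheory.EllipticCurves.Rank1Residual
  Literature.NumberTheory.EllipticCurves.Rank1Residual.Typed

namespace Summit.BirchSwinnertonDyer.Rank1Residual.Additive

open Summit.BirchSwinnertonDyer.Rank1Residual.X4

variable (W : WeierstrassCurve ℚ) [W.IsElliptic] [W.IsGloballyMinimal] (p : ℕ) [Fact p.Prime]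

/-- **A5 at `p ≥ 5`, EVERY datum: `KimRankZeroShaLengthAt W p` from the two published one-sided
facts and the modularity theorem** (`hmodN : exists_isNewformOf` pins the level of the datum to the
conductor via `IsNewformOf.level_eq_conductorNorm_of_exists_isNewformOf`). The tower binder is not
used. Flags of `hKimk` / `hE67c` inherited. [cite: Kim2022StructureSelmer, Thm. 1.9 (6) (PDF p. 8), §1.5.1 (PDF p. 7)]
[cite: DiamondShurman2005, Thm. 8.8.1] -/
theorem kimRankZeroShaLengthAt_of_kimFacts_of_five_le
    (hKimk : Kim2026.rankZero_le_padicValNat_sha_of_kuriharaNumber_ne_zero)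
    (hE67c : Kim2026.rankZero_padicValNat_sha_add_le_of_forall_pow_dvd_kuriharaNumber_cyclicLevel)
    (hmodN : exists_isNewformOf) (hp : 5 ≤ p) : KimRankZeroShaLengthAt W p :=
  fun hsurj _ hL hfin _ _ D hc hper =>
    kimShaLengthRankZeroAt_of_kimFacts_of_five_le W p hKimk hE67c hp hsurj hL hfin D hc hper
      (IsNewformOf.level_eq_conductorNorm_of_exists_isNewformOf hmodN D.isNewformOf).symm

/-- The same with the cell's standing modularity hypothesis `nonempty_modularParametrizationData`
(every globally minimal elliptic curve has a datum at its conductor; it implies `exists_isNewformOf`,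
`exists_isNewformOf_of_nonempty_modularParametrizationData`). [cite: Kim2022StructureSelmer, Thm. 1.9 (6) (PDF p. 8)]
[cite: BCDTJAMS2001, Thm. A] -/
theorem kimRankZeroShaLengthAt_of_kimFacts_of_modularParametrization_of_five_le
    (hKimk : Kim2026.rankZero_le_padicValNat_sha_of_kuriharaNumber_ne_zero)
    (hE67c : Kim2026.rankZero_padicValNat_sha_add_le_of_forall_pow_dvd_kuriharaNumber_cyclicLevel)
    (hmodD : nonempty_modularParametrizationData) (hp : 5 ≤ p) : KimRankZeroShaLengthAt W p :=
  kimRankZeroShaLengthAt_of_kimFacts_of_five_le W p hKimk hE67c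
    (exists_isNewformOf_of_nonempty_modularParametrizationData hmodD) hp

/-- **The verbatim core X1 = `X4.KimShaLengthAt W p D.f` at `p ≥ 5` in analytic rank `0` for EVERY
datum** (surj(p), `L(E,1) ≠ 0`, `Ш` finite, `p ∤ c_D`, period transfer; modularity pins the level) —
additive-p4's `X4.kimShaLengthAt_of_kimFacts_of_five_le` without the conductor-level binder.
[cite: Kim2022StructureSelmer, Thm. 1.9 (6) (PDF p. 8), §1.5.1 (PDF p. 7)] [cite: DiamondShurman2005, Thm. 8.8.1] -/
theorem kimShaLengthAt_of_kimFacts_of_exists_isNewformOf_of_five_le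
    (hKimk : Kim2026.rankZero_le_padicValNat_sha_of_kuriharaNumber_ne_zero)
    (hE67c : Kim2026.rankZero_padicValNat_sha_add_le_of_forall_pow_dvd_kuriharaNumber_cyclicLevel)
    (hmodN : exists_isNewformOf) (hp : 5 ≤ p) (hsurj : W.HasSurjectiveModNGaloisRep p)
    (hL : W.entireLFunction 1 ≠ 0) (hfin : Finite W.sha)
    {N : ℕ} [NeZero N] (D : ModularParametrizationData W N) (hc : ¬ (p : ℤ) ∣ D.maninConstant)
    (hper : ∃ u : ℚ, ‖(u : ℚ_[p])‖ = 1 ∧ W.realPeriodRat = u * plusPeriod D.f) :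
    KimShaLengthAt W p D.f :=
  kimShaLengthAt_of_kimFacts_of_five_le W p hKimk hE67c hp hsurj hL hfin D hc hper
    (IsNewformOf.level_eq_conductorNorm_of_exists_isNewformOf hmodN D.isNewformOf).symm

/-- **The three certificate shapes at `p ≥ 5`, every datum, through the top of the lattice**: F3 ∧
F4c ∧ modularity ⟹ A5 ⟹ A2 ∧ A3 ∧ A4 (`KimRankZeroUnitBoundAt`, `KimRankZeroLowerBoundAt`,
`KimRankZeroUpperDivBoundAt`). Compare the direct STEP-0 theorems `kimRankZeroUnitBoundAt_of_five_le`
(from F2), `kimRankZeroLowerBoundAt_of_five_le` (F3), `kimRankZeroUpperDivBoundAt_of_five_le` (F4,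
literal levels): here the UPPER input is the CYCLIC-level reading F4c and modularity is used.
Bookkeeping. [cite: Kim2022StructureSelmer, Thm. 1.9 (1) and (6) (PDF pp. 7–8)] -/
theorem kimRankZero_unit_lower_upperDiv_of_kimFacts_of_five_le
    (hKimk : Kim2026.rankZero_le_padicValNat_sha_of_kuriharaNumber_ne_zero)
    (hE67c : Kim2026.rankZero_padicValNat_sha_add_le_of_forall_pow_dvd_kuriharaNumber_cyclicLevel)
    (hmodN : exists_isNewformOf) (hp : 5 ≤ p) :
    KimRankZeroUnitBoundAt W p ∧ KimRankZeroLowerBoundAt W p ∧ KimRankZeroUpperDivBoundAt W p :=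
  have h5 := kimRankZeroShaLengthAt_of_kimFacts_of_five_le W p hKimk hE67c hmodN hp
  ⟨kimRankZeroUnitBoundAt_of_kimRankZeroShaLengthAt W p h5,
    kimRankZeroLowerBoundAt_of_kimRankZeroShaLengthAt W p h5,
    kimRankZeroUpperDivBoundAt_of_kimRankZeroShaLengthAt W p h5⟩

end Summit.BirchSwinnertonDyer.Rank1Residual.Additive

end
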